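import Summits.CriticalPhenomena.SAWScalingLimit.Theorems.SAWTotalPositivityBoundaryTP2Defs
import Summits.CriticalPhenomena.SAWScalingLimit.Theorems.SAWTotalPositivityBoundaryTP2Kernel
import Summits.CriticalPhenomena.SAWScalingLimit.Theorems.SAWTotalPositivityBoundaryTP2Symmetry
import Summits.CriticalPhenomena.SAWScalingLimit.Theorems.SAWTotalPositivityBoundaryTP2LadderKernelsInterior
import Summits.CriticalPhenomena.SAWScalingLimit.Theorems.EdgeOfPositivity.Negative.EdgeOfPositivityRectDomain
import HarnessLib

/-!
# Crux `BoundaryTP2` (stmt-CriticalPhenomena-7115), line `Sketch`: two bottom and two top sites of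
a ladder, interleaving `c₁ < d₂ < c₂ < d₁`, crossing pairing vs nested pairing

Tool stub `stub_ladder_bbtt_nested2` of the line's skeleton: on the ladder
`R_L = discreteDomainGraph (rectDomain L 1) 1` (sites `{0..L} × {0,1}`), for the boundary quadruple
`(c₁,0), (c₂,0)` on the bottom row and `(d₁,1), (d₂,1)` on the top row with
`c₁ < d₂ < c₂ < d₁ ≤ L` (cyclic order `(c₁,0),(c₂,0),(d₁,1),(d₂,1)`) and `0 ≤ x ≤ 1/2`, the crossing
pairing weighs at most the nested one:

  `Z((c₁,0),(d₁,1)) Z((c₂,0),(d₂,1)) ≤ Z((c₁,0),(d₂,1)) Z((c₂,0),(d₁,1))`,  `Z = pathKernel R_L x`.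

Proof. All four kernels join opposite rows. By `stub_ladderKernels_interior` (and `pathKernel_comm`
for `Z((c₂,0),(d₂,1)) = Z((d₂,1),(c₂,0))`, whose left column is `d₂`) each has the rank-two form
`x^{n+1}/2 · (a_i b_j P^n - a'_i b'_j M^n)` for left column `i`, right column `j = i + n + 1`,
`P = 1+x`, `M = 1-x`, `a_i = P + E_i`, `a'_i = M - E_i`, `b_j = P + E_{L-j}`, `b'_j = M - E_{L-j}`,
`E_k = Σ_{d<k} x^{2d+3}` (`ladderN2_kernel_cross`, `ladderN2_kernel_cross'`). Since
`E_k (1-x²) ≤ x³`, `0 ≤ E_k ≤ 1/6` on `[0, 1/2]`, so `a', b', M ≥ 0`, `a' P ≤ a M`, `b' P ≤ b M`: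
the two crossing brackets are at most their main parts `a b P^n`, and the two nested brackets `D`
satisfy `4x · a b P^n ≤ D P²`. With `u+1 = d₂-c₁`, `m+1 = c₂-d₂`, `w+1 = d₁-c₂` the crossing side
spans `2m+2` more columns, and the claim reduces to
`x^{2m+2} P^{2m+6} a_{d₂} b_{c₂} ≤ 16 x² a_{c₂} b_{d₂}`, which follows from `a_{d₂} ≤ a_{c₂}`,
`b_{c₂} ≤ b_{d₂}` (`E_k` is monotone in `k`) and the scalar bound `(xP)^{2m} P^6 ≤ (3/2)^6 ≤ 16`.
-/

noncomputable section

namespace Summit.CriticalPhenomena.SAWScalingLimit.Theorems.BoundaryTP2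

open Literature.Probability.LatticeModels Literature.Probability.RandomPlanarGeometry
open Summit.CriticalPhenomena.SAWScalingLimit.Theorems.EdgeOfPositivity.Negative
open scoped ENNReal

/-! ## The excursion sums `E_k = Σ_{d<k} x^{2d+3}` -/

-- adapted from `…BoundaryTP2LadderBbbtAdjacent` (`ladderBbbt_E_*`)

/-- `E_k ≥ 0` for `x ≥ 0`. [folklore] -/
private theorem ladderN2_E_nonneg {x : ℝ} (hx : 0 ≤ x) (k : ℕ) :
    0 ≤ ∑ d ∈ Finset.range k, x ^ (2 * d + 3) :=
  Finset.sum_nonneg fun _ _ => pow_nonneg hx _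

/-- Telescoping: `E_k (1 - x²) + x^{2k+3} = x³`. [folklore] -/
private theorem ladderN2_E_telescope (x : ℝ) (k : ℕ) :
    (∑ d ∈ Finset.range k, x ^ (2 * d + 3)) * (1 - x ^ 2) + x ^ (2 * k + 3) = x ^ 3 := by
  induction k with
  | zero => simp
  | succ k ih =>
    rw [Finset.sum_range_succ]
    linear_combination ih

/-- Powers of `x ∈ [0, 1/2]` are at most the powers of `1/2`. [folklore] -/
private theorem ladderN2_pow_le {x : ℝ} (hx0 : 0 ≤ x) (hx : x ≤ 1 / 2) (n : ℕ) :
    x ^ n ≤ (1 / 2) ^ n :=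
  pow_le_pow_left₀ hx0 hx n

/-- `E_k ≤ 1/6` for `0 ≤ x ≤ 1/2` (from `E_k (1 - x²) ≤ x³ ≤ 1/8` and `1 - x² ≥ 3/4`).
[folklore] -/
private theorem ladderN2_E_le {x : ℝ} (hx0 : 0 ≤ x) (hx : x ≤ 1 / 2) (k : ℕ) :
    ∑ d ∈ Finset.range k, x ^ (2 * d + 3) ≤ 1 / 6 := by
  have h := ladderN2_E_telescope x k
  have hE := ladderN2_E_nonneg hx0 k
  have hk : 0 ≤ x ^ (2 * k + 3) := pow_nonneg hx0 _
  have hx2 := ladderN2_pow_le hx0 hx 2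
  have hx3 := ladderN2_pow_le hx0 hx 3
  norm_num at hx2 hx3
  nlinarith [mul_nonneg hE (by linarith : (0 : ℝ) ≤ 1 / 4 - x ^ 2)]

/-- `E_k` is monotone in `k` for `x ≥ 0`. [folklore] -/
private theorem ladderN2_E_mono {x : ℝ} (hx : 0 ≤ x) {k l : ℕ} (hkl : k ≤ l) :
    ∑ d ∈ Finset.range k, x ^ (2 * d + 3) ≤ ∑ d ∈ Finset.range l, x ^ (2 * d + 3) :=
  Finset.sum_le_sum_of_subset_of_nonneg (Finset.range_mono hkl) fun _ _ _ => pow_nonneg hx _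

/-! ## The rank-two form of the opposite-row ladder kernels -/

/-- Bottom-to-top kernels of the ladder `{0..L}×{0,1}` in rank-two form: for `i + n + 1 = j ≤ L`
and `x ≥ 0`, `Z_{R_L}((i,0),(j,1)) = x^{n+1}/2 · (a_i b_j (1+x)^n - a'_i b'_j (1-x)^n)` with
`a_i = 1+x+E_i`, `a'_i = 1-x-E_i`, `b_j = 1+x+E_{L-j}`, `b'_j = 1-x-E_{L-j}` (a regrouping of
`stub_ladderKernels_interior`, sign `ε = -1` for endpoints on different rows). [folklore] -/
private theorem ladderN2_kernel_cross (L i j n : ℕ) (hn : i + n + 1 = j) (hjL : j ≤ L) {x : ℝ}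
    (hx : 0 ≤ x) :
    pathKernel (discreteDomainGraph (rectDomain L 1) 1) x (st i 0) (st j 1) =
      ENNReal.ofReal (x ^ (n + 1) / 2 *
        ((1 + x + ∑ d ∈ Finset.range i, x ^ (2 * d + 3)) *
              (1 + x + ∑ d ∈ Finset.range (L - j), x ^ (2 * d + 3)) * (1 + x) ^ n -
          (1 - x - ∑ d ∈ Finset.range i, x ^ (2 * d + 3)) *
              (1 - x - ∑ d ∈ Finset.range (L - j), x ^ (2 * d + 3)) * (1 - x) ^ n)) := by
  -- adapted from `ladderBbbt_kernel_mixed` in `…BoundaryTP2LadderBbbtAdjacent`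
  rw [stub_ladderKernels_interior L i j (by omega) hjL hx 0 1 (Or.inl rfl) (Or.inr rfl),
    if_neg (by norm_num : (0 : ℤ) ≠ 1)]
  congr 1
  subst hn
  have e1 : i + n + 1 - i = n + 1 := by omega
  have e2 : n + 1 - 1 = n := rfl
  rw [e1, e2]
  ring

/-- Top-to-bottom kernels written right endpoint first: for `i + n + 1 = j ≤ L` and `x ≥ 0`,
`Z_{R_L}((j,0),(i,1)) = Z_{R_L}((i,1),(j,0)) = x^{n+1}/2 · (a_i b_j (1+x)^n - a'_i b'_j (1-x)^n)`
(same notation; `pathKernel_comm` and `stub_ladderKernels_interior` with rows `r = 1`, `s = 0`):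
the opposite-row kernel depends on the rows only through `r ≠ s`. [folklore] -/
private theorem ladderN2_kernel_cross' (L i j n : ℕ) (hn : i + n + 1 = j) (hjL : j ≤ L) {x : ℝ}
    (hx : 0 ≤ x) :
    pathKernel (discreteDomainGraph (rectDomain L 1) 1) x (st j 0) (st i 1) =
      ENNReal.ofReal (x ^ (n + 1) / 2 *
        ((1 + x + ∑ d ∈ Finset.range i, x ^ (2 * d + 3)) *
              (1 + x + ∑ d ∈ Finset.range (L - j), x ^ (2 * d + 3)) * (1 + x) ^ n -
          (1 - x - ∑ d ∈ Finset.range i, x ^ (2 * d + 3)) *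
              (1 - x - ∑ d ∈ Finset.range (L - j), x ^ (2 * d + 3)) * (1 - x) ^ n)) := by
  rw [pathKernel_comm (discreteDomainGraph (rectDomain L 1) 1) x (st j 0) (st i 1),
    stub_ladderKernels_interior L i j (by omega) hjL hx 1 0 (Or.inr rfl) (Or.inl rfl),
    if_neg (by norm_num : (1 : ℤ) ≠ 0)]
  congr 1
  subst hn
  have e1 : i + n + 1 - i = n + 1 := by omega
  have e2 : n + 1 - 1 = n := rfl
  rw [e1, e2]
  ring

/-! ## Real inequalities in the rank-two variables -/

/-- The main part `a b (1+x)^k` of a bracket is nonnegative. [folklore] -/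
private theorem ladderN2_main_nonneg {x e f : ℝ} (k : ℕ) (hx0 : 0 ≤ x) (he : 0 ≤ e)
    (hf : 0 ≤ f) : 0 ≤ (1 + x + e) * (1 + x + f) * (1 + x) ^ k := by
  positivity

/-- Upper bound of an opposite-row bracket: `a b P^k - a' b' M^k ≤ a b P^k` (`a', b', M ≥ 0`).
[folklore] -/
private theorem ladderN2_diff_upper {x e f : ℝ} (k : ℕ) (hx : x ≤ 1 / 2) (he : e ≤ 1 / 6)
    (hf : f ≤ 1 / 6) :
    (1 + x + e) * (1 + x + f) * (1 + x) ^ k - (1 - x - e) * (1 - x - f) * (1 - x) ^ k ≤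
      (1 + x + e) * (1 + x + f) * (1 + x) ^ k :=
  sub_le_self _ (mul_nonneg (mul_nonneg (by linarith) (by linarith)) (pow_nonneg (by linarith) k))

/-- An opposite-row bracket is nonnegative: `a' b' M^k ≤ a b P^k` termwise (`a' ≤ a`,
`0 ≤ b' ≤ b`, `0 ≤ M ≤ P`). [folklore] -/
private theorem ladderN2_diff_nonneg {x e f : ℝ} (k : ℕ) (hx0 : 0 ≤ x) (hx : x ≤ 1 / 2)
    (he0 : 0 ≤ e) (hf0 : 0 ≤ f) (hf : f ≤ 1 / 6) :
    0 ≤ (1 + x + e) * (1 + x + f) * (1 + x) ^ k - (1 - x - e) * (1 - x - f) * (1 - x) ^ k :=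
  sub_nonneg.2
    (mul_le_mul (mul_le_mul (by linarith) (by linarith) (by linarith) (by linarith))
      (pow_le_pow_left₀ (by linarith) (by linarith) k) (pow_nonneg (by linarith) k)
      (mul_nonneg (by linarith) (by linarith)))

/-- The rank-two form of an opposite-row kernel is nonnegative. [folklore] -/
private theorem ladderN2_form_nonneg {x e f : ℝ} (k : ℕ) (hx0 : 0 ≤ x) (hx : x ≤ 1 / 2)
    (he0 : 0 ≤ e) (hf0 : 0 ≤ f) (hf : f ≤ 1 / 6) :
    0 ≤ x ^ (k + 1) / 2 *
      ((1 + x + e) * (1 + x + f) * (1 + x) ^ k - (1 - x - e) * (1 - x - f) * (1 - x) ^ k) :=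
  mul_nonneg (by positivity) (ladderN2_diff_nonneg k hx0 hx he0 hf0 hf)

/-- Lower bound of an opposite-row bracket: `4x · a b P^k ≤ (a b P^k - a' b' M^k) P²`, i.e.
`a' b' M^k P² ≤ a b P^k M²` (from `a' P ≤ a M`, `b' P ≤ b M`, `M^k ≤ P^k`) together with
`P² - M² = 4x`. [folklore] -/
private theorem ladderN2_diff_lower {x e f : ℝ} (k : ℕ) (hx0 : 0 ≤ x) (hx : x ≤ 1 / 2)
    (he0 : 0 ≤ e) (hf0 : 0 ≤ f) (hf : f ≤ 1 / 6) :
    4 * x * ((1 + x + e) * (1 + x + f) * (1 + x) ^ k) ≤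
      ((1 + x + e) * (1 + x + f) * (1 + x) ^ k - (1 - x - e) * (1 - x - f) * (1 - x) ^ k) *
        (1 + x) ^ 2 := by
  -- adapted from `ladderBbbt_diff_lower` in `…BoundaryTP2LadderBbbtAdjacent`
  have h1 : (1 - x - e) * (1 + x) ≤ (1 + x + e) * (1 - x) := by nlinarith
  have h2 : (1 - x - f) * (1 + x) ≤ (1 + x + f) * (1 - x) := by nlinarith
  have h3 : (1 - x) ^ k ≤ (1 + x) ^ k := pow_le_pow_left₀ (by linarith) (by linarith) k
  have key : (1 - x - e) * (1 + x) * ((1 - x - f) * (1 + x)) * (1 - x) ^ k ≤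
      (1 + x + e) * (1 - x) * ((1 + x + f) * (1 - x)) * (1 + x) ^ k :=
    mul_le_mul (mul_le_mul h1 h2 (mul_nonneg (by linarith) (by linarith))
      (mul_nonneg (by linarith) (by linarith))) h3 (pow_nonneg (by linarith) k)
      (mul_nonneg (mul_nonneg (by linarith) (by linarith)) (mul_nonneg (by linarith) (by linarith)))
  nlinarith [key]

/-- The scalar inequality `x^{2m+2} (1+x)^{2m+6} ≤ 16 x²` on `[0, 1/2]`
(`(x(1+x))^{2m} ≤ 1` and `(1+x)^6 ≤ (3/2)^6 = 729/64 ≤ 16`). [folklore] -/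
private theorem ladderN2_scalar {x : ℝ} (m : ℕ) (hx0 : 0 ≤ x) (hx : x ≤ 1 / 2) :
    x ^ (2 * m + 2) * (1 + x) ^ (2 * m + 6) ≤ 16 * x ^ 2 := by
  have h0 : 0 ≤ x * (1 + x) := mul_nonneg hx0 (by linarith)
  have h1 : x * (1 + x) ≤ 1 := by nlinarith
  have hpow : (x * (1 + x)) ^ (2 * m) ≤ 1 := pow_le_one₀ h0 h1
  have hP6 : (1 + x) ^ 6 ≤ (3 / 2) ^ 6 := pow_le_pow_left₀ (by linarith) (by linarith) 6
  have hP6' : (1 + x) ^ 6 ≤ 16 := hP6.trans (by norm_num)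
  calc x ^ (2 * m + 2) * (1 + x) ^ (2 * m + 6)
      = x ^ 2 * ((x * (1 + x)) ^ (2 * m) * (1 + x) ^ 6) := by rw [mul_pow]; ring
    _ ≤ x ^ 2 * (1 * 16) :=
        mul_le_mul_of_nonneg_left (mul_le_mul hpow hP6' (by positivity) zero_le_one)
          (pow_nonneg hx0 2)
    _ = 16 * x ^ 2 := by ring

/-- The real inequality behind `stub_ladder_bbtt_nested2`, in the rank-two variables
`e₁ = E_{c₁}`, `e₂ = E_{d₂}`, `e₃ = E_{c₂}`, `f₂ = E_{L-d₂}`, `f₃ = E_{L-c₂}`, `f₄ = E_{L-d₁}`,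
spans `d₂ - c₁ = u+1`, `c₂ - d₂ = m+1`, `d₁ - c₂ = w+1` (so `d₁ - c₁ = u+m+w+3`). [folklore] -/
private theorem ladderN2_real {x e₁ e₂ e₃ f₂ f₃ f₄ : ℝ} (u m w : ℕ) (hx0 : 0 ≤ x)
    (hx : x ≤ 1 / 2) (he₁ : 0 ≤ e₁) (he₁' : e₁ ≤ 1 / 6) (he₂ : 0 ≤ e₂) (he₂' : e₂ ≤ 1 / 6)
    (he₃ : 0 ≤ e₃) (hf₂ : 0 ≤ f₂) (hf₂' : f₂ ≤ 1 / 6) (hf₃ : 0 ≤ f₃) (hf₃' : f₃ ≤ 1 / 6)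
    (hf₄ : 0 ≤ f₄) (hf₄' : f₄ ≤ 1 / 6) (h₂₃ : e₂ ≤ e₃) (h₃₂ : f₃ ≤ f₂) :
    x ^ (u + m + w + 2 + 1) / 2 *
          ((1 + x + e₁) * (1 + x + f₄) * (1 + x) ^ (u + m + w + 2) -
            (1 - x - e₁) * (1 - x - f₄) * (1 - x) ^ (u + m + w + 2)) *
        (x ^ (m + 1) / 2 *
          ((1 + x + e₂) * (1 + x + f₃) * (1 + x) ^ m - (1 - x - e₂) * (1 - x - f₃) * (1 - x) ^ m)) ≤
      x ^ (u + 1) / 2 *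
          ((1 + x + e₁) * (1 + x + f₂) * (1 + x) ^ u - (1 - x - e₁) * (1 - x - f₂) * (1 - x) ^ u) *
        (x ^ (w + 1) / 2 *
          ((1 + x + e₃) * (1 + x + f₄) * (1 + x) ^ w -
            (1 - x - e₃) * (1 - x - f₄) * (1 - x) ^ w)) := by
  have hP : 0 ≤ 1 + x := by linarith
  have hP4 : 0 < (1 + x) ^ 4 := by positivity
  -- the two crossing brackets from above, the two nested brackets from below
  have U14 := ladderN2_diff_upper (u + m + w + 2) hx he₁' hf₄'
  have U23 := ladderN2_diff_upper m hx he₂' hf₃'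
  have D23 := ladderN2_diff_nonneg m hx0 hx he₂ hf₃ hf₃'
  have A14 := ladderN2_main_nonneg (u + m + w + 2) hx0 he₁ hf₄
  have L12 := ladderN2_diff_lower u hx0 hx he₁ hf₂ hf₂'
  have L34 := ladderN2_diff_lower w hx0 hx he₃ hf₄ hf₄'
  have A34 : 0 ≤ 4 * x * ((1 + x + e₃) * (1 + x + f₄) * (1 + x) ^ w) :=
    mul_nonneg (by positivity) (ladderN2_main_nonneg w hx0 he₃ hf₄)
  have B12 : 0 ≤ ((1 + x + e₁) * (1 + x + f₂) * (1 + x) ^ u -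
      (1 - x - e₁) * (1 - x - f₂) * (1 - x) ^ u) * (1 + x) ^ 2 :=
    mul_nonneg (ladderN2_diff_nonneg u hx0 hx he₁ hf₂ hf₂') (pow_nonneg hP 2)
  -- the key comparison of the middle factors
  have key : x ^ (2 * m + 2) * (1 + x) ^ (2 * m + 6) * ((1 + x + e₂) * (1 + x + f₃)) ≤
      16 * x ^ 2 * ((1 + x + e₃) * (1 + x + f₂)) :=
    mul_le_mul (ladderN2_scalar m hx0 hx)
      (mul_le_mul (by linarith) (by linarith) (by linarith) (by linarith)) (by positivity)
      (by positivity)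
  refine le_of_mul_le_mul_right ?_ hP4
  calc x ^ (u + m + w + 2 + 1) / 2 *
          ((1 + x + e₁) * (1 + x + f₄) * (1 + x) ^ (u + m + w + 2) -
            (1 - x - e₁) * (1 - x - f₄) * (1 - x) ^ (u + m + w + 2)) *
        (x ^ (m + 1) / 2 *
          ((1 + x + e₂) * (1 + x + f₃) * (1 + x) ^ m -
            (1 - x - e₂) * (1 - x - f₃) * (1 - x) ^ m)) * (1 + x) ^ 4
      = x ^ (u + m + w + 2 + 1) / 2 * (x ^ (m + 1) / 2) *
          (((1 + x + e₁) * (1 + x + f₄) * (1 + x) ^ (u + m + w + 2) -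
              (1 - x - e₁) * (1 - x - f₄) * (1 - x) ^ (u + m + w + 2)) *
            ((1 + x + e₂) * (1 + x + f₃) * (1 + x) ^ m -
              (1 - x - e₂) * (1 - x - f₃) * (1 - x) ^ m)) * (1 + x) ^ 4 := by ring
    _ ≤ x ^ (u + m + w + 2 + 1) / 2 * (x ^ (m + 1) / 2) *
          ((1 + x + e₁) * (1 + x + f₄) * (1 + x) ^ (u + m + w + 2) *
            ((1 + x + e₂) * (1 + x + f₃) * (1 + x) ^ m)) * (1 + x) ^ 4 :=
        mul_le_mul_of_nonneg_right
          (mul_le_mul_of_nonneg_left (mul_le_mul U14 U23 D23 A14) (by positivity))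
          (by positivity)
    _ = x ^ (u + 1) * x ^ (w + 1) / 4 * ((1 + x + e₁) * (1 + x + f₄)) *
          (1 + x) ^ (u + w) *
          (x ^ (2 * m + 2) * (1 + x) ^ (2 * m + 6) * ((1 + x + e₂) * (1 + x + f₃))) := by ring
    _ ≤ x ^ (u + 1) * x ^ (w + 1) / 4 * ((1 + x + e₁) * (1 + x + f₄)) *
          (1 + x) ^ (u + w) * (16 * x ^ 2 * ((1 + x + e₃) * (1 + x + f₂))) :=
        mul_le_mul_of_nonneg_left key (by positivity)
    _ = x ^ (u + 1) / 2 * (x ^ (w + 1) / 2) *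
          (4 * x * ((1 + x + e₁) * (1 + x + f₂) * (1 + x) ^ u) *
            (4 * x * ((1 + x + e₃) * (1 + x + f₄) * (1 + x) ^ w))) := by ring
    _ ≤ x ^ (u + 1) / 2 * (x ^ (w + 1) / 2) *
          (((1 + x + e₁) * (1 + x + f₂) * (1 + x) ^ u -
                (1 - x - e₁) * (1 - x - f₂) * (1 - x) ^ u) * (1 + x) ^ 2 *
            (((1 + x + e₃) * (1 + x + f₄) * (1 + x) ^ w -
                (1 - x - e₃) * (1 - x - f₄) * (1 - x) ^ w) * (1 + x) ^ 2)) :=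
        mul_le_mul_of_nonneg_left (mul_le_mul L12 L34 A34 B12) (by positivity)
    _ = x ^ (u + 1) / 2 *
          ((1 + x + e₁) * (1 + x + f₂) * (1 + x) ^ u - (1 - x - e₁) * (1 - x - f₂) * (1 - x) ^ u) *
        (x ^ (w + 1) / 2 *
          ((1 + x + e₃) * (1 + x + f₄) * (1 + x) ^ w -
            (1 - x - e₃) * (1 - x - f₄) * (1 - x) ^ w)) * (1 + x) ^ 4 := by ring

/-! ## The stub -/

/-- **Tool stub `stub_ladder_bbtt_nested2`.** On the ladder `{0..L}×{0,1}`, for bottom sites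
`(c₁,0), (c₂,0)` and top sites `(d₁,1), (d₂,1)` with the interleaving `c₁ < d₂ < c₂ < d₁ ≤ L`
(cyclic order `(c₁,0),(c₂,0),(d₁,1),(d₂,1)`), and `0 ≤ x ≤ 1/2`: the crossing pairing weighs at
most the NESTED one, `Z((c₁,0),(d₁,1)) Z((c₂,0),(d₂,1)) ≤ Z((c₁,0),(d₂,1)) Z((c₂,0),(d₁,1))`.
Mechanism: all four kernels join opposite rows and have the rank-two form
`x^{n+1}/2 · (a b P^n - a' b' M^n)` (`ladderN2_kernel_cross`, `ladderN2_kernel_cross'`); the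
crossing brackets are at most their main parts `a b P^n`, the nested ones at least
`4x/P² · a b P^n`; the crossing product carries the extra factor `(x(1+x))^{2(c₂-d₂)}`, and
`x^{2m+2} P^{2m+6} ≤ 16 x²` on `[0, 1/2]`; the end corrections `E_k` only help (`E` is monotone
in `k`). [folklore] -/
theorem stub_ladder_bbtt_nested2 (L : ℕ) {c₁ c₂ d₂ d₁ : ℕ} (h₁ : c₁ < d₂) (h₂ : d₂ < c₂) (h₃ : c₂ < d₁)
    (h₄ : d₁ ≤ L) {x : ℝ} (hx0 : 0 ≤ x) (hx : x ≤ 1 / 2) :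
    pathKernel (discreteDomainGraph (rectDomain L 1) 1) x (st c₁ 0) (st d₁ 1) *
        pathKernel (discreteDomainGraph (rectDomain L 1) 1) x (st c₂ 0) (st d₂ 1) ≤
      pathKernel (discreteDomainGraph (rectDomain L 1) 1) x (st c₁ 0) (st d₂ 1) *
        pathKernel (discreteDomainGraph (rectDomain L 1) 1) x (st c₂ 0) (st d₁ 1) := by
  obtain ⟨u, hu⟩ : ∃ u, d₂ = c₁ + u + 1 := ⟨d₂ - c₁ - 1, by omega⟩
  obtain ⟨m, hm⟩ : ∃ m, c₂ = d₂ + m + 1 := ⟨c₂ - d₂ - 1, by omega⟩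
  obtain ⟨w, hw⟩ : ∃ w, d₁ = c₂ + w + 1 := ⟨d₁ - c₂ - 1, by omega⟩
  have hE := fun k => ladderN2_E_nonneg hx0 k
  have hE' := fun k => ladderN2_E_le hx0 hx k
  rw [ladderN2_kernel_cross L c₁ d₁ (u + m + w + 2) (by omega) h₄ hx0,
    ladderN2_kernel_cross' L d₂ c₂ m (by omega) (by omega) hx0,
    ladderN2_kernel_cross L c₁ d₂ u (by omega) (by omega) hx0,
    ladderN2_kernel_cross L c₂ d₁ w (by omega) h₄ hx0,
    ← ENNReal.ofReal_mul
      (ladderN2_form_nonneg (u + m + w + 2) hx0 hx (hE c₁) (hE (L - d₁)) (hE' (L - d₁))),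
    ← ENNReal.ofReal_mul
      (ladderN2_form_nonneg u hx0 hx (hE c₁) (hE (L - d₂)) (hE' (L - d₂)))]
  exact ENNReal.ofReal_le_ofReal (ladderN2_real u m w hx0 hx (hE c₁) (hE' c₁) (hE d₂) (hE' d₂)
    (hE c₂) (hE (L - d₂)) (hE' (L - d₂)) (hE (L - c₂)) (hE' (L - c₂)) (hE (L - d₁)) (hE' (L - d₁))
    (ladderN2_E_mono hx0 (by omega : d₂ ≤ c₂)) (ladderN2_E_mono hx0 (by omega : L - c₂ ≤ L - d₂)))

end Summit.CriticalPhenomena.SAWScalingLimit.Theorems.BoundaryTP2
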